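import Summits.FinalStateConjecture.FinalStateConjecture.Theorems.ClusterCompletenessAdiabaticMultiKerrILEDFiniteTimeEnergy
import HarnessLib

/-!
# Crux `LinearToNonlinearCapture` (stmt-FinalStateConjecture-14526), line `two-pins-and-completeness` —
# stub `stub_scalarRateFreeDecay`, helper: local energy propagation at base time `0`

Helper file (`--supports stmt-FinalStateConjecture-14526`) for the registered stub
`stub_scalarRateFreeDecay : AdiabaticMultiKerrILED → ScalarRateFreeDecay` of the skeleton
`LinearToNonlinearCapture` (route `ClusterCompleteness`).

The LOCAL form of the finite-time energy estimate `stub_finiteTimeEnergy`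
(`…AdiabaticMultiKerrILEDFiniteTimeEnergy.lean`) on the tails-cut patched multi-Kerr background of the
engine `AdiabaticMultiKerrILED`: for a smooth solution `ψ` of the divergence-form equation on
`{x⁰ ≥ 0}` outside the horizons, the local energy in `{‖y‖ ≤ R}` (outside the horizons) at lab time
`T ∈ [0, 1]` is at most `18(1+Φ)² e^{192(1+Φ)D}` times the local energy in `{‖y‖ ≤ R + 2}` at lab
time `0`. Here `(Φ, D)` is the pointwise package of the field (`stub_cruxFieldPointwise`: normalised
Kerr–Schild form with profile `≤ Φ`, derivative bound `D`, exact boosted Kerr in `{rᵢ ≤ 8Mᵢ}`), taken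
as EXPLICIT hypotheses so that the constant is uniform when the configuration is translated in time
(the sibling helper `…TwoPinsTimeShift.lean`). Proof = the proof of `stub_finiteTimeEnergy` with the
cone apex `A = T + R + 1` kept finite: weight `stub_slabWeight`, slab Grönwall `stub_slabGronwall`,
`∑(∂ψ)² ≤ 6 T^{00} ≤ 18(1+Φ)² ∑(∂ψ)²` pointwise, the support of the weight at time `0` lies in
`{‖y‖ < A} ⊆ {‖y‖ ≤ R + 2}`, and the horizon layers are removed by monotone convergence
(`θ → 0`; NO `R → ∞`). Hawking–Ellis 1973, §4.3, Lemma 4.3.1 (weighted form);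
Dafermos–Rodnianski arXiv:0811.0354, App. D. [folklore]
-/

noncomputable section

-- the doubled `FinalStateConjecture.FinalStateConjecture` path component trips dupNamespace
set_option linter.dupNamespace false

open scoped ContDiff Topology InnerProductSpace BigOperators ENNReal
open MeasureTheory Metric Set Filter Literature.Geometry.Lorentzian

namespace Summit.FinalStateConjecture.FinalStateConjecture.Theorems.ClusterCompleteness.TwoPins

open Summit.FinalStateConjecture.FinalStateConjecture.Cruxes.AdiabaticMultiKerrILED.Sketch

/-- **Local energy propagation at base time `0` (domain of dependence, weighted form).** On the
tails-cut patched multi-Kerr background of a `40`-separated, strictly receding configuration with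
`|aᵢ| ≤ Mᵢ/2` and lab speeds `≤ 1/2`, given the pointwise package `(Φ, D)` of the field (normalised
Kerr–Schild form with profile `≤ Φ` at exterior points with `x⁰ ≥ 0`, first-derivative bound `D` on
the exterior, exact boosted Kerr inside `{rᵢ ≤ 8Mᵢ}`), every smooth `ψ` solving the equation at the
exterior points with `x⁰ ≥ 0` satisfies, for `0 ≤ T ≤ 1` and every `R`,
`∫_{‖y‖ ≤ R, ext} Σ(∂ψ)²(T, y) dy ≤ 18(1+Φ)² e^{192(1+Φ)D} ∫_{‖y‖ ≤ R+2, ext} Σ(∂ψ)²(0, y) dy`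
(cone apex `A = T + R + 1`; Hawking–Ellis 1973, §4.3, Lemma 4.3.1, weighted form). [folklore] -/
theorem srfd_localEnergyZero :
    ∀ {N : ℕ} (M a : Fin N → ℝ) (Λ : Fin N → lorentzGroup) (p : Fin N → E3) (u : Fin N → E4)
      (q : Fin N → E4 → E4),
      (∀ i, u i = (Λ i : E4 ≃L[ℝ] E4) (E4.basisVector 0)) →
      (∀ i x, q i x = poincareInv (Λ i) (E4.ofTimeSpace 0 (p i)) x) →
      (∀ i, 0 < M i) → (∀ i, |a i| ≤ 2⁻¹ * M i) →
      (∀ i, 0 < u i 0 ∧ ‖E4.spatial (u i)‖ ≤ 2⁻¹ * u i 0) →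
      (∀ i j, i ≠ j → 40 * (M i + M j) ≤ dist (p i) (p j) ∧
        0 < ⟪p i - p j, (u i 0)⁻¹ • E4.spatial (u i) - (u j 0)⁻¹ • E4.spatial (u j)⟫_ℝ) →
      ∀ (G : E4 → Fin 4 → Fin 4 → ℝ),
      (∀ x μ ν, G x μ ν = Minkowski.bilin (E4.basisVector μ) (E4.basisVector ν) -
        ∑ i, Real.smoothTransition (2 - Kerr.radius (a i) (q i x) / (8 * M i)) *
          (2 * Kerr.scalarH (M i) (a i) (q i x)) *
          ((Λ i : E4 ≃L[ℝ] E4) (Kerr.nullVector (a i) (q i x))) μ *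
          ((Λ i : E4 ≃L[ℝ] E4) (Kerr.nullVector (a i) (q i x))) ν) →
      ∀ (Φ D : ℝ), 0 ≤ Φ → 0 ≤ D →
      (∀ x : E4, 0 ≤ x 0 → (∀ i, Kerr.rPlus (M i) (a i) < Kerr.radius (a i) (q i x)) →
        ∃ (φ₀ : ℝ) (l₀ : E4), 0 ≤ φ₀ ∧ φ₀ ≤ Φ ∧
          Minkowski.bilin l₀ l₀ = 0 ∧ Minkowski.bilin l₀ (E4.basisVector 0) = 1 ∧
          ∀ μ ν, G x μ ν = Kerr.etaComp μ ν - φ₀ * l₀ μ * l₀ ν) →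
      (∀ x : E4, (∀ i, Kerr.rPlus (M i) (a i) < Kerr.radius (a i) (q i x)) →
        ∀ μ α β : Fin 4, |fderiv ℝ (fun y ↦ G y α β) x (E4.basisVector μ)| ≤ D) →
      (∀ x : E4, 0 ≤ x 0 → ∀ i, Kerr.radius (a i) (q i x) ≤ 8 * M i →
        ∀ μ ν, G x μ ν = Minkowski.bilin (E4.basisVector μ) (E4.basisVector ν) -
          2 * Kerr.scalarH (M i) (a i) (q i x) *
            ((Λ i : E4 ≃L[ℝ] E4) (Kerr.nullVector (a i) (q i x))) μ *
            ((Λ i : E4 ≃L[ℝ] E4) (Kerr.nullVector (a i) (q i x))) ν) →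
      ∀ ψ : E4 → ℝ, ContDiff ℝ ∞ ψ →
        (∀ x : E4, 0 ≤ x 0 → (∀ i, Kerr.rPlus (M i) (a i) < Kerr.radius (a i) (q i x)) →
          ∑ μ : Fin 4, fderiv ℝ (fun y ↦ ∑ ν : Fin 4, G y μ ν * fderiv ℝ ψ y (E4.basisVector ν)) x
            (E4.basisVector μ) = 0) →
        ∀ R T : ℝ, 0 ≤ T → T ≤ 1 →
          ∫⁻ y in {y : E3 | ‖y‖ ≤ R ∧ ∀ i, Kerr.rPlus (M i) (a i) <
              Kerr.radius (a i) (q i (E4.ofTimeSpace T y))},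
            ENNReal.ofReal (∑ μ : Fin 4, (fderiv ℝ ψ (E4.ofTimeSpace T y) (E4.basisVector μ)) ^ 2) ≤
          ENNReal.ofReal (18 * (1 + Φ) ^ 2 * Real.exp (192 * (1 + Φ) * D)) *
            ∫⁻ y in {y : E3 | ‖y‖ ≤ R + 2 ∧ ∀ i, Kerr.rPlus (M i) (a i) <
                Kerr.radius (a i) (q i (E4.ofTimeSpace 0 y))},
              ENNReal.ofReal (∑ μ : Fin 4, (fderiv ℝ ψ (E4.ofTimeSpace 0 y) (E4.basisVector μ)) ^ 2) := by
  intro N M a Λ p u q hu hq hM ha hv hsep G hG Φ D hΦ0 hD0 hKS hDb hlayer ψ hψ hsol R T hT0 hT1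
  -- the local energy at time `0` in the ball of radius `R + 2`
  set X0 : Set E3 := {y : E3 | ‖y‖ ≤ R + 2 ∧ ∀ i, Kerr.rPlus (M i) (a i) <
      Kerr.radius (a i) (q i (E4.ofTimeSpace 0 y))} with hX0def
  set g0 : E3 → ℝ := fun y ↦
    ∑ μ : Fin 4, (fderiv ℝ ψ (E4.ofTimeSpace 0 y) (E4.basisVector μ)) ^ 2 with hg0def
  set L0 : ℝ≥0∞ := ∫⁻ y in X0, ENNReal.ofReal (g0 y) with hL0
  -- ### trivial cases: `R < 0` (empty ball) and infinite initial local energy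
  rcases lt_or_ge R 0 with hRneg | hR
  · have hempty : {y : E3 | ‖y‖ ≤ R ∧ ∀ i, Kerr.rPlus (M i) (a i) <
        Kerr.radius (a i) (q i (E4.ofTimeSpace T y))} = ∅ :=
      Set.eq_empty_of_forall_notMem fun y hy ↦ by
        have := norm_nonneg y
        linarith [hy.1]
    rw [hempty, Measure.restrict_empty, lintegral_zero_measure]
    exact bot_le
  have hKpos : 0 < 18 * (1 + Φ) ^ 2 * Real.exp (192 * (1 + Φ) * D) := by positivity
  by_cases htop : L0 = ⊤
  · rw [htop, ENNReal.mul_top (ENNReal.ofReal_pos.mpr hKpos).ne']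
    exact le_top
  -- ### continuity bookkeeping
  have h0c : Continuous fun x : E4 ↦ x 0 := (contDiff_apply_zero (n := 0)).continuous
  have hqcont : ∀ i, Continuous (q i) := fun i ↦ by
    have : q i = poincareInv (Λ i) (E4.ofTimeSpace 0 (p i)) := funext (hq i)
    rw [this]; exact continuous_poincareInv _ _
  have hrcont : ∀ i, Continuous fun x : E4 ↦ Kerr.radius (a i) (q i x) := fun i ↦
    (Kerr.continuous_radius (a i)).comp (hqcont i)
  have hhcont : ∀ i, Continuous fun x : E4 ↦ Kerr.horizonFn (M i) (a i) (q i x) := fun i ↦ by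
    unfold Kerr.horizonFn
    exact ((hrcont i).sub continuous_const).mul
      (Real.continuous_exp.comp (continuous_const.mul (h0c.comp (hqcont i))).neg)
  have hgcont : ∀ s, Continuous fun y : E3 ↦
      ∑ μ : Fin 4, (fderiv ℝ ψ (E4.ofTimeSpace s y) (E4.basisVector μ)) ^ 2 := fun s ↦ by
    refine continuous_finsetSum _ fun μ _ ↦ ?_
    exact (((hψ.continuous_fderiv (by simp)).comp (E4.continuous_ofTimeSpace s)).clm_apply
      continuous_const).pow 2
  have hgnn : ∀ s y, 0 ≤ ∑ μ : Fin 4, (fderiv ℝ ψ (E4.ofTimeSpace s y) (E4.basisVector μ)) ^ 2 :=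
    fun s y ↦ Finset.sum_nonneg fun _ _ ↦ sq_nonneg _
  have hX0meas : MeasurableSet X0 := by
    have h1 : IsClosed {y : E3 | ‖y‖ ≤ R + 2} := isClosed_le continuous_norm continuous_const
    have h2 : IsOpen {y : E3 | ∀ i, Kerr.rPlus (M i) (a i) <
        Kerr.radius (a i) (q i (E4.ofTimeSpace 0 y))} := by
      rw [Set.setOf_forall]
      exact isOpen_iInter_of_finite fun i ↦ isOpen_lt continuous_const
        ((hrcont i).comp (E4.continuous_ofTimeSpace 0))
    have : X0 = {y : E3 | ‖y‖ ≤ R + 2} ∩ {y : E3 | ∀ i, Kerr.rPlus (M i) (a i) <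
        Kerr.radius (a i) (q i (E4.ofTimeSpace 0 y))} := by
      ext y; simp only [hX0def, Set.mem_setOf_eq, Set.mem_inter_iff]
    rw [this]
    exact h1.measurableSet.inter h2.measurableSet
  -- ### the truncated estimate (horizon layers of width `θ`)
  have key : ∀ θ : ℝ, 0 < θ → (∀ i, θ ≤ 6 * M i) →
      ∫⁻ y in {y : E3 | ‖y‖ ≤ R ∧ ∀ i, Kerr.rPlus (M i) (a i) + θ ≤
          Kerr.radius (a i) (q i (E4.ofTimeSpace T y))},
        ENNReal.ofReal (∑ μ : Fin 4, (fderiv ℝ ψ (E4.ofTimeSpace T y) (E4.basisVector μ)) ^ 2) ≤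
        ENNReal.ofReal (18 * (1 + Φ) ^ 2 * Real.exp (192 * (1 + Φ) * D * T)) * L0 := by
    intro θ hθ hθM
    have hTA : T < T + R + 1 := by linarith
    set B : Fin N → ℝ := fun i ↦
      ‖((Λ i : E4 ≃L[ℝ] E4).symm : E4 →L[ℝ] E4)‖ * (T + (T + R + 1 + 2) + ‖p i‖) with hB
    set ε : Fin N → ℝ := fun i ↦ θ / 2 * Real.exp (-((2 * M i)⁻¹ * B i)) with hε
    have hεpos : ∀ i, 0 < ε i := fun i ↦ by positivity
    have h2ε : ∀ i, 2 * ε i = θ * Real.exp (-((2 * M i)⁻¹ * B i)) := fun i ↦ by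
      simp only [hε]; ring
    have hexp : ∀ i (x : E4), 0 ≤ x 0 → x 0 ≤ T → E4.spatialNorm x ≤ T + R + 1 + 2 →
        Real.exp (-((2 * M i)⁻¹ * B i)) ≤ Real.exp (-((2 * M i)⁻¹ * (q i x) 0)) := by
      intro i x hx0 hxT hxρ
      rw [hq i x]
      exact fte_exp_restTime_le (Λ i) (p i) (hM i) hx0 hxT hxρ
    set W : E4 → ℝ := fun x ↦ Kerr.timeSlabCutoff T (T + R + 1) (x 0) *
        Real.smoothTransition (Kerr.coneFn (T + R + 1) 0 x) *
        ∏ i, Real.smoothTransition (Kerr.horizonFn (M i) (a i) (q i x) / ε i - 1) with hWdef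
    obtain ⟨hWC1, hW01, hWsupp, hWone, hWflux⟩ :=
      stub_slabWeight M a Λ p u q hu hq hM ha hv hsep G hG T (T + R + 1) ε hTA hεpos W (fun x ↦ rfl)
    set K : Set E4 := {x : E4 | -2 ≤ x 0 ∧ x 0 ≤ T + R + 1 ∧ E4.spatialNorm x ≤ T + R + 1 + 2 ∧
      ∀ i, ε i ≤ Kerr.horizonFn (M i) (a i) (q i x)} with hKdef
    have hKclosed : IsClosed K := fte_isClosed_slabSet hhcont ε (T + R + 1) (T + R + 1 + 2)
    have hextK : ∀ x ∈ K, ∀ i, Kerr.rPlus (M i) (a i) < Kerr.radius (a i) (q i x) := by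
      intro x hx i
      have hpos : 0 < Kerr.horizonFn (M i) (a i) (q i x) := (hεpos i).trans_le (hx.2.2.2 i)
      unfold Kerr.horizonFn at hpos
      have := (mul_pos_iff_of_pos_right (Real.exp_pos _)).mp hpos
      linarith
    have hWK : ∀ x, W x ≠ 0 → x ∈ K := by
      intro x hWx
      obtain ⟨h1, h2, h3, h4⟩ := hWsupp x hWx
      exact ⟨h1.le, h2.le, by linarith, fun i ↦ (h4 i).le⟩
    have hG2K : ∀ x ∈ K, ∀ μ ν, ContDiffAt ℝ 2 (fun y ↦ G y μ ν) x := fun x hx μ ν ↦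
      (contDiffAt_cruxField_of_exterior hq hM hG (hextK x hx) μ ν).of_le
        (WithTop.coe_le_coe.mpr le_top)
    have hsolK : ∀ x ∈ K, 0 ≤ x 0 → x 0 ≤ T → KerrSchild.waveOperator G ψ x = 0 := by
      intro x hx hx0 _
      rw [← cruxWave_eq_waveOperator]
      exact hsol x hx0 (hextK x hx)
    have hKSK : ∀ x ∈ K, 0 ≤ x 0 → x 0 ≤ T →
        ∃ (φ₀ : ℝ) (l₀ : E4), 0 ≤ φ₀ ∧ φ₀ ≤ Φ ∧
          Minkowski.bilin l₀ l₀ = 0 ∧ Minkowski.bilin l₀ (E4.basisVector 0) = 1 ∧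
          ∀ μ ν, G x μ ν = Kerr.etaComp μ ν - φ₀ * l₀ μ * l₀ ν :=
      fun x hx hx0 _ ↦ hKS x hx0 (hextK x hx)
    have hlayK : ∀ x ∈ K, 0 ≤ x 0 → x 0 ≤ T → ∀ i,
        Kerr.horizonFn (M i) (a i) (q i x) ≤ 2 * ε i → Kerr.radius (a i) (q i x) ≤ 8 * M i := by
      intro x hx hx0 hxT i hh
      have he := hexp i x hx0 hxT hx.2.2.1
      have hr : Kerr.rPlus (M i) (a i) < Kerr.radius (a i) (q i x) := hextK x hx i
      rw [h2ε i] at hh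
      unfold Kerr.horizonFn at hh
      have hsub : Kerr.radius (a i) (q i x) - Kerr.rPlus (M i) (a i) ≤ θ :=
        fte_le_of_mul_exp_le (Real.exp_pos _) he (by linarith) hh
      have h2M : Kerr.rPlus (M i) (a i) ≤ 2 * M i := by
        have hs : Real.sqrt (M i ^ 2 - a i ^ 2) ≤ Real.sqrt (M i ^ 2) :=
          Real.sqrt_le_sqrt (sub_le_self _ (sq_nonneg _))
        rw [Real.sqrt_sq (hM i).le] at hs
        unfold Kerr.rPlus; linarith
      linarith [hθM i]
    have hfluxK : ∀ x ∈ K, 0 ≤ x 0 → x 0 ≤ T →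
        ∑ μ, fderiv ℝ W x (E4.basisVector μ) * KerrSchild.normalCurrent G ψ x μ ≤ 0 := by
      intro x hx hx0 hxT
      obtain ⟨φ₀, l₀, hφ0, -, hnull, hnorm, hGx⟩ := hKS x hx0 (hextK x hx)
      refine hWflux ψ x hx0 hxT (hextK x hx) ⟨φ₀, l₀, hφ0, hnull, hnorm, hGx⟩ ?_
      intro i hh
      exact hlayer x hx0 i (hlayK x hx hx0 hxT i hh)
    have hgron := stub_slabGronwall G W ψ K Φ D T (T + R + 1 + 2) hΦ0 hD0 hT0 hKclosed
      (fun x hx ↦ hx.2.2.1) hWC1 (fun x ↦ (hW01 x).1) hWK hG2K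
      (fun x _ μ ν ↦ cruxField_symm hG x μ ν) hψ hsolK hKSK
      (fun x hx _ _ ↦ hDb x (hextK x hx)) hfluxK T hT0 le_rfl
    have hJcont : Continuous fun x : E4 ↦ W x * KerrSchild.normalCurrent G ψ x 0 := by
      refine continuous_iff_continuousAt.mpr fun x ↦ ?_
      refine continuousAt_weight_mul hKclosed (subset_refl K) hWC1.continuous
        (fun y hy ↦ ?_) (fun y hy ↦ ?_) x
      · by_contra h
        exact hy (hWK y h)
      · exact (fte_contDiffAt_normalCurrent (fun μ ν ↦ (hG2K y hy μ ν).of_le one_le_two)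
          (hψ.contDiffAt.of_le (WithTop.coe_le_coe.mpr le_top)) 0).continuousAt
    have hJnn : ∀ s, 0 ≤ s → s ≤ T → ∀ y : E3,
        0 ≤ W (E4.ofTimeSpace s y) * KerrSchild.normalCurrent G ψ (E4.ofTimeSpace s y) 0 := by
      intro s hs0 hst y
      by_cases hWy : W (E4.ofTimeSpace s y) = 0
      · rw [hWy, zero_mul]
      · have hyK := hWK _ hWy
        obtain ⟨φ₀, l₀, hφ0, hφΦ, hnull, hnorm, hGx⟩ :=
          hKSK _ hyK (by rw [E4.ofTimeSpace_apply_zero]; exact hs0)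
            (by rw [E4.ofTimeSpace_apply_zero]; exact hst)
        exact mul_nonneg (hW01 _).1 (fte_pointwise ψ hφ0 hφΦ hnull hnorm hGx).1
    set S : Set E3 := {y : E3 | ‖y‖ ≤ R ∧ ∀ i, Kerr.rPlus (M i) (a i) + θ ≤
        Kerr.radius (a i) (q i (E4.ofTimeSpace T y))} with hSdef
    have hSball : S ⊆ closedBall (0 : E3) (T + R + 1 + 2) := fun y hy ↦ by
      rw [mem_closedBall, dist_zero_right]; linarith [hy.1]
    have hSclosed : IsClosed S :=
      fte_isClosed_truncSet (fun i ↦ (hrcont i).comp (E4.continuous_ofTimeSpace T)) _ R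
    have hWS : ∀ y ∈ S, W (E4.ofTimeSpace T y) = 1 := by
      intro y hy
      apply hWone
      · rw [E4.ofTimeSpace_apply_zero]; exact hT0
      · rw [E4.ofTimeSpace_apply_zero]
      · simp only [Kerr.coneFn, E4.ofTimeSpace_apply_zero, E4.spatial_ofTimeSpace, sub_zero]
        nlinarith [hy.1, norm_nonneg y]
      · intro i
        have hr := hy.2 i
        have he := hexp i (E4.ofTimeSpace T y) (by rw [E4.ofTimeSpace_apply_zero]; exact hT0)
          (by rw [E4.ofTimeSpace_apply_zero]) (by rw [E4.spatialNorm_ofTimeSpace]; linarith [hy.1])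
        rw [h2ε i]
        unfold Kerr.horizonFn
        calc θ * Real.exp (-((2 * M i)⁻¹ * B i))
            ≤ θ * Real.exp (-((2 * M i)⁻¹ * (q i (E4.ofTimeSpace T y)) 0)) :=
              mul_le_mul_of_nonneg_left he hθ.le
          _ ≤ (Kerr.radius (a i) (q i (E4.ofTimeSpace T y)) - Kerr.rPlus (M i) (a i)) *
                Real.exp (-((2 * M i)⁻¹ * (q i (E4.ofTimeSpace T y)) 0)) :=
              mul_le_mul_of_nonneg_right (by linarith) (Real.exp_pos _).le
    have hcoer : ∀ y ∈ S, (∑ μ : Fin 4, (fderiv ℝ ψ (E4.ofTimeSpace T y) (E4.basisVector μ)) ^ 2) ≤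
        6 * (W (E4.ofTimeSpace T y) * KerrSchild.normalCurrent G ψ (E4.ofTimeSpace T y) 0) := by
      intro y hy
      rw [hWS y hy, one_mul]
      have hext' : ∀ i, Kerr.rPlus (M i) (a i) < Kerr.radius (a i) (q i (E4.ofTimeSpace T y)) :=
        fun i ↦ by have := hy.2 i; linarith
      obtain ⟨φ₀, l₀, hφ0, hφΦ, hnull, hnorm, hGx⟩ :=
        hKS (E4.ofTimeSpace T y) (by rw [E4.ofTimeSpace_apply_zero]; exact hT0) hext'
      exact (fte_pointwise ψ hφ0 hφΦ hnull hnorm hGx).2.1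
    have hJint : ∀ s, IntegrableOn (fun y : E3 ↦ W (E4.ofTimeSpace s y) *
        KerrSchild.normalCurrent G ψ (E4.ofTimeSpace s y) 0) (closedBall (0 : E3) (T + R + 1 + 2)) :=
      fun s ↦ (hJcont.comp (E4.continuous_ofTimeSpace s)).continuousOn.integrableOn_compact
        (isCompact_closedBall _ _)
    have hgint : IntegrableOn (fun y : E3 ↦
        ∑ μ : Fin 4, (fderiv ℝ ψ (E4.ofTimeSpace T y) (E4.basisVector μ)) ^ 2) S :=
      (((hgcont T).continuousOn).integrableOn_compact (isCompact_closedBall _ _)).mono_set hSball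
    -- the initial weighted energy is controlled by the LOCAL energy in `{‖y‖ ≤ R + 2}`
    have step0 : (∫ y in closedBall (0 : E3) (T + R + 1 + 2), W (E4.ofTimeSpace 0 y) *
        KerrSchild.normalCurrent G ψ (E4.ofTimeSpace 0 y) 0) ≤ 3 * (1 + Φ) ^ 2 * L0.toReal := by
      have hpt : ∀ y, W (E4.ofTimeSpace 0 y) * KerrSchild.normalCurrent G ψ (E4.ofTimeSpace 0 y) 0 ≤
          3 * (1 + Φ) ^ 2 * X0.indicator g0 y := by
        intro y
        by_cases hWy : W (E4.ofTimeSpace 0 y) = 0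
        · rw [hWy, zero_mul]
          exact mul_nonneg (by positivity) (Set.indicator_nonneg (fun _ _ ↦ hgnn 0 _) _)
        · have hyK := hWK _ hWy
          have hyA : ‖y‖ ≤ R + 2 := by
            have h3 := (hWsupp _ hWy).2.2.1
            rw [E4.spatialNorm_ofTimeSpace, E4.ofTimeSpace_apply_zero] at h3
            linarith
          have hyX : y ∈ X0 := ⟨hyA, fun i ↦ hextK _ hyK i⟩
          rw [Set.indicator_of_mem hyX]
          obtain ⟨φ₀, l₀, hφ0, hφΦ, hnull, hnorm, hGx⟩ :=
            hKSK _ hyK (by rw [E4.ofTimeSpace_apply_zero]) (by rw [E4.ofTimeSpace_apply_zero]; exact hT0)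
          have hp := fte_pointwise ψ hφ0 hφΦ hnull hnorm hGx
          calc W (E4.ofTimeSpace 0 y) * KerrSchild.normalCurrent G ψ (E4.ofTimeSpace 0 y) 0
              ≤ 1 * KerrSchild.normalCurrent G ψ (E4.ofTimeSpace 0 y) 0 :=
                mul_le_mul_of_nonneg_right (hW01 _).2 hp.1
            _ = _ := one_mul _
            _ ≤ 3 * (1 + Φ) ^ 2 * g0 y := hp.2.2
      have hg0int : IntegrableOn g0 (closedBall (0 : E3) (T + R + 1 + 2)) :=
        (hgcont 0).continuousOn.integrableOn_compact (isCompact_closedBall _ _)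
      have hind_int : IntegrableOn (X0.indicator g0) (closedBall (0 : E3) (T + R + 1 + 2)) :=
        hg0int.indicator hX0meas
      have hfin : (∫⁻ y in X0 ∩ closedBall (0 : E3) (T + R + 1 + 2), ENNReal.ofReal (g0 y)) ≤ L0 :=
        lintegral_mono_set Set.inter_subset_left
      calc (∫ y in closedBall (0 : E3) (T + R + 1 + 2), W (E4.ofTimeSpace 0 y) *
              KerrSchild.normalCurrent G ψ (E4.ofTimeSpace 0 y) 0)
          ≤ ∫ y in closedBall (0 : E3) (T + R + 1 + 2), 3 * (1 + Φ) ^ 2 * X0.indicator g0 y :=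
            setIntegral_mono (hJint 0) (hind_int.const_mul _) hpt
        _ = 3 * (1 + Φ) ^ 2 * ∫ y in closedBall (0 : E3) (T + R + 1 + 2), X0.indicator g0 y :=
            integral_const_mul _ _
        _ = 3 * (1 + Φ) ^ 2 * ∫ y in X0 ∩ closedBall (0 : E3) (T + R + 1 + 2), g0 y := by
            rw [integral_indicator hX0meas, Measure.restrict_restrict hX0meas]
        _ = 3 * (1 + Φ) ^ 2 *
              (∫⁻ y in X0 ∩ closedBall (0 : E3) (T + R + 1 + 2), ENNReal.ofReal (g0 y)).toReal := by
            rw [integral_eq_lintegral_of_nonneg_ae (Eventually.of_forall fun y ↦ hgnn 0 y)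
              ((hgcont 0).aestronglyMeasurable)]
        _ ≤ 3 * (1 + Φ) ^ 2 * L0.toReal :=
            mul_le_mul_of_nonneg_left (ENNReal.toReal_mono htop hfin) (by positivity)
    have hreal : ∫ y in S, (∑ μ : Fin 4, (fderiv ℝ ψ (E4.ofTimeSpace T y) (E4.basisVector μ)) ^ 2) ≤
        18 * (1 + Φ) ^ 2 * Real.exp (192 * (1 + Φ) * D * T) * L0.toReal := by
      have step1 : ∫ y in S, (∑ μ : Fin 4, (fderiv ℝ ψ (E4.ofTimeSpace T y) (E4.basisVector μ)) ^ 2) ≤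
          ∫ y in S, 6 * (W (E4.ofTimeSpace T y) *
            KerrSchild.normalCurrent G ψ (E4.ofTimeSpace T y) 0) :=
        setIntegral_mono_on hgint (((hJint T).mono_set hSball).const_mul 6)
          hSclosed.measurableSet hcoer
      have step2 : ∫ y in S, 6 * (W (E4.ofTimeSpace T y) *
            KerrSchild.normalCurrent G ψ (E4.ofTimeSpace T y) 0) =
          6 * ∫ y in S, W (E4.ofTimeSpace T y) *
            KerrSchild.normalCurrent G ψ (E4.ofTimeSpace T y) 0 := integral_const_mul _ _
      have step3 : (∫ y in S, W (E4.ofTimeSpace T y) *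
            KerrSchild.normalCurrent G ψ (E4.ofTimeSpace T y) 0) ≤
          ∫ y in closedBall (0 : E3) (T + R + 1 + 2), W (E4.ofTimeSpace T y) *
            KerrSchild.normalCurrent G ψ (E4.ofTimeSpace T y) 0 :=
        setIntegral_mono_set (hJint T) (Eventually.of_forall (hJnn T hT0 le_rfl))
          (Eventually.of_forall hSball)
      have hexp0 : 0 ≤ Real.exp (192 * (1 + Φ) * D * T) := (Real.exp_pos _).le
      have step4 : (∫ y in closedBall (0 : E3) (T + R + 1 + 2), W (E4.ofTimeSpace T y) *
            KerrSchild.normalCurrent G ψ (E4.ofTimeSpace T y) 0) ≤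
          3 * (1 + Φ) ^ 2 * L0.toReal * Real.exp (192 * (1 + Φ) * D * T) :=
        hgron.trans (mul_le_mul_of_nonneg_right step0 hexp0)
      calc _ ≤ _ := step1
        _ = _ := step2
        _ ≤ 6 * (3 * (1 + Φ) ^ 2 * L0.toReal * Real.exp (192 * (1 + Φ) * D * T)) := by
            linarith [step3, step4]
        _ = _ := by ring
    have hlhs : ∫⁻ y in S, ENNReal.ofReal
        (∑ μ : Fin 4, (fderiv ℝ ψ (E4.ofTimeSpace T y) (E4.basisVector μ)) ^ 2) =
        ENNReal.ofReal (∫ y in S,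
          ∑ μ : Fin 4, (fderiv ℝ ψ (E4.ofTimeSpace T y) (E4.basisVector μ)) ^ 2) :=
      (ofReal_integral_eq_lintegral_ofReal hgint (Eventually.of_forall fun y ↦ hgnn T y)).symm
    rw [hlhs]
    calc ENNReal.ofReal (∫ y in S, ∑ μ : Fin 4, (fderiv ℝ ψ (E4.ofTimeSpace T y) (E4.basisVector μ)) ^ 2)
        ≤ ENNReal.ofReal (18 * (1 + Φ) ^ 2 * Real.exp (192 * (1 + Φ) * D * T) * L0.toReal) :=
          ENNReal.ofReal_le_ofReal hreal
      _ = ENNReal.ofReal (18 * (1 + Φ) ^ 2 * Real.exp (192 * (1 + Φ) * D * T)) *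
            ENNReal.ofReal (L0.toReal) := ENNReal.ofReal_mul (by positivity)
      _ = _ := by rw [ENNReal.ofReal_toReal htop]
  -- ### exhaustion of the exterior inside the fixed ball (`θ → 0`)
  obtain ⟨θ₀, hθ₀, hθ₀M⟩ := fte_exists_margin hM
  obtain ⟨hmono, hUnion⟩ := fte_iUnion_truncSet
    (fun i (y : E3) ↦ Kerr.radius (a i) (q i (E4.ofTimeSpace T y))) (fun i ↦ Kerr.rPlus (M i) (a i)) hθ₀
  have hset : {y : E3 | ‖y‖ ≤ R ∧ ∀ i, Kerr.rPlus (M i) (a i) <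
      Kerr.radius (a i) (q i (E4.ofTimeSpace T y))} =
      ⋃ n : ℕ, ({y : E3 | ‖y‖ ≤ R} ∩ {y : E3 | ‖y‖ ≤ (n : ℝ) + 1 ∧
        ∀ i, Kerr.rPlus (M i) (a i) + θ₀ / ((n : ℝ) + 1) ≤
          Kerr.radius (a i) (q i (E4.ofTimeSpace T y))}) := by
    rw [← Set.inter_iUnion, ← hUnion]
    ext y
    simp only [Set.mem_setOf_eq, Set.mem_inter_iff]
  have hmono' : Monotone fun n : ℕ ↦ ({y : E3 | ‖y‖ ≤ R} ∩ {y : E3 | ‖y‖ ≤ (n : ℝ) + 1 ∧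
      ∀ i, Kerr.rPlus (M i) (a i) + θ₀ / ((n : ℝ) + 1) ≤
        Kerr.radius (a i) (q i (E4.ofTimeSpace T y))}) :=
    fun m n hmn ↦ Set.inter_subset_inter_right _ (hmono hmn)
  have hdir := hmono'.directed_le
  rw [hset, setLIntegral_iUnion_of_directed _ hdir]
  refine iSup_le fun n ↦ ?_
  have hθn : 0 < θ₀ / ((n : ℝ) + 1) := by positivity
  have hθnM : ∀ i, θ₀ / ((n : ℝ) + 1) ≤ 6 * M i := fun i ↦
    (div_le_self hθ₀.le (by linarith [n.cast_nonneg (α := ℝ)])).trans (hθ₀M i)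
  have hsub : ({y : E3 | ‖y‖ ≤ R} ∩ {y : E3 | ‖y‖ ≤ (n : ℝ) + 1 ∧
      ∀ i, Kerr.rPlus (M i) (a i) + θ₀ / ((n : ℝ) + 1) ≤
        Kerr.radius (a i) (q i (E4.ofTimeSpace T y))}) ⊆
      {y : E3 | ‖y‖ ≤ R ∧ ∀ i, Kerr.rPlus (M i) (a i) + θ₀ / ((n : ℝ) + 1) ≤
        Kerr.radius (a i) (q i (E4.ofTimeSpace T y))} := fun y hy ↦ ⟨hy.1, hy.2.2⟩
  refine (lintegral_mono_set hsub).trans ((key _ hθn hθnM).trans ?_)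
  refine mul_le_mul_of_nonneg_right (ENNReal.ofReal_le_ofReal ?_) bot_le
  refine mul_le_mul_of_nonneg_left (Real.exp_le_exp.mpr ?_) (by positivity)
  have hC0 : 0 ≤ 192 * (1 + Φ) * D := by positivity
  calc 192 * (1 + Φ) * D * T ≤ 192 * (1 + Φ) * D * 1 := mul_le_mul_of_nonneg_left hT1 hC0
    _ = _ := mul_one _

end Summit.FinalStateConjecture.FinalStateConjecture.Theorems.ClusterCompleteness.TwoPins

end
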